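import Summits.ABC.ABC.Theses.DefiniteXi
import Summits.ABC.ABC.Theorems.XiBound.Negative.XiBoundDomainSetup
import Summits.ABC.ABC.Theorems.DefiniteXiXiBoundFreyEisensteinModFour
import Summits.ABC.ABC.Theorems.DefiniteXiXiBoundXiDvdTwelve
import Summits.ABC.ABC.Theorems.DefiniteXiXiBoundHeckeProjectorExists
import Summits.ABC.ABC.Theorems.DefiniteXiXiBoundSzpiroBootstrap
import Summits.ABC.ABC.Theorems.RibetTakahashiSplitManyPrimeValuationProductBootstrap
import Literature.NumberTheory.EllipticCurves.PastenValuationProductTamagawaProofs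

/-!
# Line `two-adic-redei-depth` for crux `XiBound` (stmt-ABC-11336, route `DefiniteXi`) — rev 6 (lead prover; rev 3/4 = planner route-choice repairs 06:44Z/07:57Z)

Crux (by name): `Summit.ABC.ABC.Theses.DefiniteXi.XiBound` —
`∃ A C, ∀` Frey curves `E_(a,b)` (`a, b` coprime, `ab(a+b) ≠ 0`, `N` = conductor) and every admissible
`N⁻ = Nm` (odd, squarefree, odd `ω`, `Nm ∣ N`): `ξ(E; N/Nm, Nm) ≤ C · N^A`, `ξ = brandtXi`.

Idea (Ideas/two-adic-redei-depth.md, ideator 1; triage r1: pass, pass, fail-as-line): slice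
`ξ = 2^{v₂ ξ} · ξ_odd` and attack the 2-primary slice through the one feature that is specific to
Frey–Hellegouarch curves — the residual representation `ρ̄_(E,2)` is TRIVIAL (`E[2] ⊂ E(ℚ)`, so
`a_p ≡ p + 1 (mod 4)` at every odd good prime): the 2-adic depth of `φ_E` in the Brandt module is a
congruence exponent inside the Eisenstein-at-2 cluster `𝕋_𝔪`, `𝔪 = (2, T_p − p − 1)`, whose structure
is governed by the pro-2 quotient of `G_(ℚ,S)` (Koch presentation; Rédei symbols of the primes of
`abc`; Calegari–Emerton at prime level).  The censuses (kit j007442, 175 Frey curves, N ≤ 5520;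
kit j013237/j013418, 31 Mersenne/Fermat Frey curves, N ≤ 1.05·10⁶) found the FIXED-SHAPE law
`v₂(deg φ_E) ≤ Σ_{q ∣ N odd} v₂(q² − 1) + 3` without exception; triage 2 asked for exactly that shape.

Skeleton rev 6 (lead; 4 sorried = registered open stubs {3b, 4a = r3, 4b = r9, 5}, glue sorry-free, `XiBound_of` concludes the
route decl BY NAME).  History: rev 1 planner (5 stubs); rev 2 lead (instance binders, Pasten split
4a/4b); rev 3/4 planners' route-choice repairs (06:44Z PROMOTE, 07:57Z RE-ROUTE: Pasten leaves the
line, allowance paid by a SZPIRO BOOTSTRAP through route items r3/r9); rev 5 lead (stubs 1, 2 replaced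
by the landed theorems; stub 3 split into 3a existence — proved by the wave-1 worker — and 3b the bare
2-adic law for the least Hecke denominator; `of_parts_delta` + `exponentProductFrey_of_polySzpiro`
realise the bootstrap wiring):

* stub 1 — LANDED `Summit.ABC.ABC.Theorems.stub_freyEisensteinModFour` (p86425);
* stub 2 — LANDED `Summit.ABC.ABC.Theorems.stub_xiDvdTwelveCongruenceExponent` (p90654);
* stub 3a — LANDED `Summit.ABC.ABC.Theorems.stub_heckeProjectorExists` (p94365);
* `stub_twoAdicLawMinimalExponent` (3b) — THE MECHANISM (load-bearing, XL, open): the least such `D`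
  has `v₂(D) ≤ Σ_{q ∣ N, q odd} v₂(q² − 1) + B · Σ_{p ∣ N/Nm} v₂(ord_p Δ_min) + B · ω(N) + B`;
* `stub_definiteRTControlPrime` (4a) = route item DefiniteRTControlPrime (r3, known in print, XL debt);
* `stub_freyModularity` (4b) = route item FreyModularity (r9, Wiles/BCDT, XL debt);
* stub 4c — LANDED `Summit.ABC.ABC.Theorems.stub_szpiroBootstrap` (p92472): 4a → 4b → (δ-weak
  ξ-bound) → polynomial Szpiro on Frey curves;
* `stub_oddPartXiBound` (5) — the odd part of `ξ` is polynomial (the abc-hard residual; no lever).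

Reduction (`of_parts`, checked): `ξ = 2^{v₂ξ} · ξ_odd`; on a line, `ξ ∣ 12 D` gives
`v₂ ξ ≤ v₂ 12 + v₂ D < 12 + law`; `2^{Σ_q v₂(q²−1)} ≤ ∏ q² ≤ N²`, `2^{Σ_p v₂(v_p)} ≤ ∏_{p∣N} v_p`,
`2^{ω(N)} ≤ N`; hence `ξ ≤ 2^{12+B} · N^{2+B} · (∏ v_p)^B · ξ_odd ≤ 2^{12+B} C₄^B C₅ · N^{2+B+A₄B+A₅}`.
Off a line / without the bound being needed, `ξ = 0`.  Disproof/Negative modules honoured: the setup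
on the crux's domain comes from the LANDED `Negative.nonempty_xiSetup_freyCurve` (XiBoundDomainSetup);
no stub is a finite-census claim (XiBoundLocks `xiBound_violators_infinite`); `stub_oddPartXiBound`
keeps the Takahashi squeeze's abc-strength (XiBoundTakahashiSqueeze) — it is not claimed easier.
-/

-- `Summit.<Summit>.<Problem>`: for the single-conjunct summit `ABC` the duplicate `ABC.ABC` is mandated.
set_option linter.dupNamespace false

namespace Summit.ABC.ABC.Cruxes.XiBound.TwoAdicRedeiDepth

open scoped BigOperators Classical
open Literature.NumberTheory.Automorphic Literature.NumberTheory.EllipticCurves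
open Summit.ABC.ABC.Theorems.XiBound.Negative

/-! ## Registered stubs -/

/-! ### Discharged stubs (landed under `Summits/ABC/ABC/Theorems/`, imported above)

* stub 1 `stub_freyEisensteinModFour` (4 ∣ p + 1 − a_p(E_(a,b)) at odd good p) =
  `Summit.ABC.ABC.Theorems.stub_freyEisensteinModFour` (DefiniteXiXiBoundFreyEisensteinModFour, p86425);
* stub 2 `stub_xiDvdTwelveCongruenceExponent` (ξ ∣ 12·D whenever D·π_φ is integral) =
  `Summit.ABC.ABC.Theorems.stub_xiDvdTwelveCongruenceExponent` (DefiniteXiXiBoundXiDvdTwelve, p90654;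
  with `Literature.NumberTheory.Automorphic.Brandt.XiSetup.weight_dvd_twelve`, p87919);
* stub 3a `stub_heckeProjectorExists` (some `D·π_φ` is an integral Hecke operator) =
  `Summit.ABC.ABC.Theorems.stub_heckeProjectorExists` (DefiniteXiXiBoundHeckeProjectorExists, p94365;
  Literature `Brandt.exists_heckeProjector`, BrandtHeckeProjector.lean p93812 / BrandtWeightedPairing p92386);
* stub 4c `stub_szpiroBootstrap` (RT → modularity → δ-weak ξ-bound → polynomial Szpiro) =
  `Summit.ABC.ABC.Theorems.stub_szpiroBootstrap` (DefiniteXiXiBoundSzpiroBootstrap, p92472);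
* (retired from the composition by the planners' rev 4, still landed) stub 4b
  `Summit.ABC.ABC.Theorems.stub_exponentProductFreyOfPasten` (DefiniteXiXiBoundExponentProductFrey, p89276).
-/

/-- **stub 3b — the 2-adic law for the LEAST Hecke denominator (THE MECHANISM; the line's open
core, XL).**  There is an absolute `B` such that for every Frey curve `E_(a,b)` (form Eisenstein mod 4
at the odd good primes — always, stub 1), every admissible type `(N/Nm, Nm)`, every setup `S`, every
generator `φ` of the `a(E)`-eigen-line and every `D > 0` that is MINIMAL among the `D'` with
`D' · π_φ ∈ ℤ[B(n) : n ≥ 1]` (such `D` exist by stub 3a; the admissible `D'` are exactly the positive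
multiples of the least one), `v₂(D) ≤ Σ_{q ∣ N, q odd} v₂(q² − 1) + B · Σ_{p ∣ N/Nm} v₂(ord_p Δ_min(E))
+ B · ω(N) + B`.  Rev-5 split of the planners' `stub_twoAdicCongruenceExponent` (= 3a ∧ 3b exactly,
`twoAdicCongruenceExponent_of_stubs` below).  Reading, plausibility, risks: see the line card —
the 2-adic depth to which `(a_p(E))` meets the other Hecke eigen-systems of the Brandt module should be
bounded by the 2-adic precision of the local data at the primes of `N` (Koch/Rédei), the level-lowering
congruences of `f_E` at the unquarantined `p ∣ N/Nm` (allowance, 2-part `v₂(ord_p Δ_min)`), and `O(ω(N))`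
sign/genus bookkeeping; the surplus of this RING statement over the lattice one (`v₂ ξ`) is the
non-Gorenstein defect at the 2-Eisenstein maximal ideal (Calegari–Emerton 2005).  OPEN. -/
theorem stub_twoAdicLawMinimalExponent :
    ∃ B : ℕ, ∀ a b : ℤ, IsCoprime a b → a * b * (a + b) ≠ 0 →
      (∀ p : ℕ, p.Prime → p ≠ 2 → ¬ (p : ℤ) ∣ a * b * (a + b) →
        (4 : ℤ) ∣ (p : ℤ) + 1 - (freyCurve a b).LFunction p) →
      ∀ (N : ℕ) [NeZero N], (freyCurve a b).conductorNorm ℤ = N →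
      ∀ Nm : ℕ, Odd Nm → Squarefree Nm → Odd Nm.primeFactors.card → Nm ∣ N →
      ∀ (S : Brandt.XiSetup (N / Nm) Nm) [Fintype (Brandt.ClassSet S.O)],
        ∀ φ : Brandt.ClassSet S.O → ℤ, φ ≠ 0 →
          Brandt.eigenLattice (N / Nm * Nm) (Brandt.matrix S.O)
              (fun n => (freyCurve a b).LFunction n) = ℤ ∙ φ →
          ∀ D : ℕ, 0 < D →
            (∃ M ∈ Algebra.adjoin ℤ (Set.range fun n : ℕ => Brandt.matrix S.O (n + 1)),
              ∀ c d : Brandt.ClassSet S.O,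
                (S.xi (fun n => (freyCurve a b).LFunction n) : ℤ) * M c d =
                  (D : ℤ) * (Brandt.weight S.O d : ℤ) * φ d * φ c) →
            (∀ D' : ℕ, 0 < D' →
              (∃ M' ∈ Algebra.adjoin ℤ (Set.range fun n : ℕ => Brandt.matrix S.O (n + 1)),
                ∀ c d : Brandt.ClassSet S.O,
                  (S.xi (fun n => (freyCurve a b).LFunction n) : ℤ) * M' c d =
                    (D' : ℤ) * (Brandt.weight S.O d : ℤ) * φ d * φ c) → D ≤ D') →
            D.factorization 2 ≤
              ∑ q ∈ N.primeFactors.erase 2, (q ^ 2 - 1).factorization 2 +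
                B * ∑ p ∈ (N / Nm).primeFactors,
                  (((freyCurve a b).minimalDiscriminantNorm ℤ).factorization p).factorization 2 +
                B * N.primeFactors.card + B := by
  sorry

/-- **The planners' stub 3 (`stub_twoAdicCongruenceExponent`, registry rev 1–4) from 3a ∧ 3b** (sorry-free
glue): take the least admissible `D` (`Nat.find` on stub 3a) and apply stub 3b to it. -/
theorem twoAdicCongruenceExponent_of_stubs
    (h3a : ∀ {Nplus Nminus : ℕ} (S : Brandt.XiSetup Nplus Nminus) (lam : ℕ → ℤ)
      [Fintype (Brandt.ClassSet S.O)],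
      ∀ φ : Brandt.ClassSet S.O → ℤ, φ ≠ 0 →
        Brandt.eigenLattice (Nplus * Nminus) (Brandt.matrix S.O) lam = ℤ ∙ φ →
        ∃ D : ℕ, 0 < D ∧
          ∃ M ∈ Algebra.adjoin ℤ (Set.range fun n : ℕ => Brandt.matrix S.O (n + 1)),
            ∀ c d : Brandt.ClassSet S.O,
              (S.xi lam : ℤ) * M c d = (D : ℤ) * (Brandt.weight S.O d : ℤ) * φ d * φ c)
    (h3b : ∃ B : ℕ, ∀ a b : ℤ, IsCoprime a b → a * b * (a + b) ≠ 0 →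
      (∀ p : ℕ, p.Prime → p ≠ 2 → ¬ (p : ℤ) ∣ a * b * (a + b) →
        (4 : ℤ) ∣ (p : ℤ) + 1 - (freyCurve a b).LFunction p) →
      ∀ (N : ℕ) [NeZero N], (freyCurve a b).conductorNorm ℤ = N →
      ∀ Nm : ℕ, Odd Nm → Squarefree Nm → Odd Nm.primeFactors.card → Nm ∣ N →
      ∀ (S : Brandt.XiSetup (N / Nm) Nm) [Fintype (Brandt.ClassSet S.O)],
        ∀ φ : Brandt.ClassSet S.O → ℤ, φ ≠ 0 →
          Brandt.eigenLattice (N / Nm * Nm) (Brandt.matrix S.O)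
              (fun n => (freyCurve a b).LFunction n) = ℤ ∙ φ →
          ∀ D : ℕ, 0 < D →
            (∃ M ∈ Algebra.adjoin ℤ (Set.range fun n : ℕ => Brandt.matrix S.O (n + 1)),
              ∀ c d : Brandt.ClassSet S.O,
                (S.xi (fun n => (freyCurve a b).LFunction n) : ℤ) * M c d =
                  (D : ℤ) * (Brandt.weight S.O d : ℤ) * φ d * φ c) →
            (∀ D' : ℕ, 0 < D' →
              (∃ M' ∈ Algebra.adjoin ℤ (Set.range fun n : ℕ => Brandt.matrix S.O (n + 1)),
                ∀ c d : Brandt.ClassSet S.O,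
                  (S.xi (fun n => (freyCurve a b).LFunction n) : ℤ) * M' c d =
                    (D' : ℤ) * (Brandt.weight S.O d : ℤ) * φ d * φ c) → D ≤ D') →
            D.factorization 2 ≤
              ∑ q ∈ N.primeFactors.erase 2, (q ^ 2 - 1).factorization 2 +
                B * ∑ p ∈ (N / Nm).primeFactors,
                  (((freyCurve a b).minimalDiscriminantNorm ℤ).factorization p).factorization 2 +
                B * N.primeFactors.card + B) :
    ∃ B : ℕ, ∀ a b : ℤ, IsCoprime a b → a * b * (a + b) ≠ 0 →
      (∀ p : ℕ, p.Prime → p ≠ 2 → ¬ (p : ℤ) ∣ a * b * (a + b) →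
        (4 : ℤ) ∣ (p : ℤ) + 1 - (freyCurve a b).LFunction p) →
      ∀ (N : ℕ) [NeZero N], (freyCurve a b).conductorNorm ℤ = N →
      ∀ Nm : ℕ, Odd Nm → Squarefree Nm → Odd Nm.primeFactors.card → Nm ∣ N →
      ∀ (S : Brandt.XiSetup (N / Nm) Nm) [Fintype (Brandt.ClassSet S.O)],
        ∀ φ : Brandt.ClassSet S.O → ℤ, φ ≠ 0 →
          Brandt.eigenLattice (N / Nm * Nm) (Brandt.matrix S.O)
              (fun n => (freyCurve a b).LFunction n) = ℤ ∙ φ →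
          ∃ D : ℕ, 0 < D ∧
            D.factorization 2 ≤
              ∑ q ∈ N.primeFactors.erase 2, (q ^ 2 - 1).factorization 2 +
                B * ∑ p ∈ (N / Nm).primeFactors,
                  (((freyCurve a b).minimalDiscriminantNorm ℤ).factorization p).factorization 2 +
                B * N.primeFactors.card + B ∧
            ∃ M ∈ Algebra.adjoin ℤ (Set.range fun n : ℕ => Brandt.matrix S.O (n + 1)),
              ∀ c d : Brandt.ClassSet S.O,
                (S.xi (fun n => (freyCurve a b).LFunction n) : ℤ) * M c d =
                  (D : ℤ) * (Brandt.weight S.O d : ℤ) * φ d * φ c := by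
  obtain ⟨B, hB⟩ := h3b
  refine ⟨B, fun a b hab h0 h4 N _ hN Nm hodd hsq hcard hdvd S _ φ hφ hL => ?_⟩
  have hex : ∃ D : ℕ, 0 < D ∧
      ∃ M ∈ Algebra.adjoin ℤ (Set.range fun n : ℕ => Brandt.matrix S.O (n + 1)),
        ∀ c d : Brandt.ClassSet S.O,
          (S.xi (fun n => (freyCurve a b).LFunction n) : ℤ) * M c d =
            (D : ℤ) * (Brandt.weight S.O d : ℤ) * φ d * φ c :=
    h3a S _ φ hφ hL
  obtain ⟨hDpos, M, hM, hMcd⟩ := Nat.find_spec hex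
  have hmin : ∀ D' : ℕ, 0 < D' →
      (∃ M' ∈ Algebra.adjoin ℤ (Set.range fun n : ℕ => Brandt.matrix S.O (n + 1)),
        ∀ c d : Brandt.ClassSet S.O,
          (S.xi (fun n => (freyCurve a b).LFunction n) : ℤ) * M' c d =
            (D' : ℤ) * (Brandt.weight S.O d : ℤ) * φ d * φ c) → Nat.find hex ≤ D' :=
    fun D' hD' hM' => Nat.find_min' hex ⟨hD', hM'⟩
  exact ⟨Nat.find hex,
    hDpos, hB a b hab h0 h4 N hN Nm hodd hsq hcard hdvd S φ hφ hL _ hDpos ⟨M, hM, hMcd⟩ hmin,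
    M, hM, hMcd⟩

/-- **stub 4a — the definite Ribet–Takahashi comparison, prime form = route item `DefiniteRTControlPrime`
(stmt-ABC-11338, rank 3; KNOWN in print: Takahashi 2001 Thm 2.3/3.8 + Pasten Thm 6.1; XL formal debt).**
Registered BY NAME by the planners' rev 4 (route-choice repair 07:57Z): the allowance of stub 3 is paid by a
Szpiro bootstrap through the route's own items instead of Pasten's exponent product. Not worked by this
line's workers — it is a route item served to provers in its own right. -/
theorem stub_definiteRTControlPrime : Summit.ABC.ABC.Theses.DefiniteXi.DefiniteRTControlPrime := by
  sorry

/-- **stub 4b — modularity of Frey curves in datum form = route item `FreyModularity` (stmt-ABC-11340;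
Wiles 1995 / BCDT 2001; XL formal debt).**  Registered BY NAME by the planners' rev 4; not worked here. -/
theorem stub_freyModularity : Summit.ABC.ABC.Theses.DefiniteXi.FreyModularity := by
  sorry

/-- **stub 5 — the odd part of `ξ` is polynomial (the abc-hard residual; hardest stub overall).**
`ξ / 2^{v₂ ξ} ≤ C · N^A` for every Frey curve and admissible type (`ordCompl[2] ξ`; junk `ξ = 0` gives
`0`).  This is the crux with its 2-primary part removed and carries its polynomial-Szpiro strength
(Negative/XiBoundTakahashiSqueeze: `ξ ≍ δ_opt` up to `c_r` on the prime-`N⁻` part) — NO lever is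
claimed here (triage 3's objection, accepted: honest residual).  It composes with the sibling line
`max-quarantine-reduction`: odd part at MAXIMAL type + an odd-primary ratio control (Pollack–Weston
Thm 6.8 / Ribet–Takahashi, known type for `ℓ ≥ 5`) + stub 4 give it at every type.  Size XL / open. -/
theorem stub_oddPartXiBound :
    ∃ A C : ℝ, ∀ a b : ℤ, IsCoprime a b → a * b * (a + b) ≠ 0 → ∀ (N : ℕ) [NeZero N],
      (freyCurve a b).conductorNorm ℤ = N → ∀ Nm : ℕ, Odd Nm → Squarefree Nm →
      Odd Nm.primeFactors.card → Nm ∣ N →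
      ((brandtXi (N / Nm) Nm (fun n => (freyCurve a b).LFunction n) /
          2 ^ (brandtXi (N / Nm) Nm (fun n => (freyCurve a b).LFunction n)).factorization 2 : ℕ) : ℝ)
        ≤ C * (N : ℝ) ^ A := by
  sorry

/-! ## The reduction (sorry-free) -/

/-- `2 ^ Σ_{q ∣ N, q ≠ 2} v₂(q² − 1) ≤ N²` (`2^{v₂ m} ≤ m`, `∏_{q ∣ N} q ∣ N`). -/
theorem two_pow_sum_factorization_sq_sub_one_le {N : ℕ} (hN : N ≠ 0) :
    2 ^ ∑ q ∈ N.primeFactors.erase 2, (q ^ 2 - 1).factorization 2 ≤ N ^ 2 := by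
  rw [← Finset.prod_pow_eq_pow_sum]
  have hrad : 0 < ∏ q ∈ N.primeFactors, q ^ 2 :=
    Finset.prod_pos fun q hq => pow_pos (Nat.prime_of_mem_primeFactors hq).pos 2
  calc ∏ q ∈ N.primeFactors.erase 2, 2 ^ (q ^ 2 - 1).factorization 2
      ≤ ∏ q ∈ N.primeFactors.erase 2, q ^ 2 := by
        refine Finset.prod_le_prod (fun _ _ => Nat.zero_le _) fun q hq => ?_
        have hq2 : 2 ≤ q := (Nat.prime_of_mem_primeFactors (Finset.mem_of_mem_erase hq)).two_le
        have hq0 : q ^ 2 - 1 ≠ 0 := by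
          have : 4 ≤ q ^ 2 := by nlinarith
          omega
        exact (Nat.ordProj_le 2 hq0).trans (Nat.sub_le _ _)
    _ ≤ ∏ q ∈ N.primeFactors, q ^ 2 :=
        Nat.le_of_dvd hrad (Finset.prod_dvd_prod_of_subset _ _ _ (Finset.erase_subset _ _))
    _ = (∏ q ∈ N.primeFactors, q) ^ 2 := (Finset.prod_pow _ 2 _)
    _ ≤ N ^ 2 := Nat.pow_le_pow_left
        (Nat.le_of_dvd (Nat.pos_of_ne_zero hN) (Nat.prod_primeFactors_dvd N)) 2

/-- `2 ^ ω(N) ≤ N` for `N ≠ 0`. -/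
theorem two_pow_card_primeFactors_le {N : ℕ} (hN : N ≠ 0) : 2 ^ N.primeFactors.card ≤ N := by
  calc 2 ^ N.primeFactors.card = ∏ _q ∈ N.primeFactors, 2 := (Finset.prod_const 2).symm
    _ ≤ ∏ q ∈ N.primeFactors, q :=
        Finset.prod_le_prod (fun _ _ => Nat.zero_le _) fun q hq =>
          (Nat.prime_of_mem_primeFactors hq).two_le
    _ ≤ N := Nat.le_of_dvd (Nat.pos_of_ne_zero hN) (Nat.prod_primeFactors_dvd N)

/-- `2 ^ Σ_{p ∈ s} v₂(v_p) ≤ ∏_{p ∈ t} v_p` for `s ⊆ t` and `v_p ≠ 0` on `t`. -/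
theorem two_pow_sum_factorization_le_prod {s t : Finset ℕ} (v : ℕ → ℕ) (hst : s ⊆ t)
    (hv : ∀ p ∈ t, v p ≠ 0) : 2 ^ ∑ p ∈ s, (v p).factorization 2 ≤ ∏ p ∈ t, v p := by
  rw [← Finset.prod_pow_eq_pow_sum]
  calc ∏ p ∈ s, 2 ^ (v p).factorization 2 ≤ ∏ p ∈ s, v p :=
        Finset.prod_le_prod (fun _ _ => Nat.zero_le _) fun p hp => Nat.ordProj_le 2 (hv p (hst hp))
    _ ≤ ∏ p ∈ t, v p :=
        Nat.le_of_dvd (Finset.prod_pos fun p hp => Nat.pos_of_ne_zero (hv p hp))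
          (Finset.prod_dvd_prod_of_subset s t v hst)

/-- The arithmetic core: an exponent bounded by the law of stub 3 (plus the `12` of stub 2) gives a
power of two that is polynomial in `N` and in the exponent product `P = ∏_{p ∣ N} v_p`. -/
theorem two_pow_le_of_law {N B e : ℕ} (hN : N ≠ 0) {s : Finset ℕ} (v : ℕ → ℕ)
    (hs : s ⊆ N.primeFactors) (hv : ∀ p ∈ N.primeFactors, v p ≠ 0)
    (he : e ≤ 12 + (∑ q ∈ N.primeFactors.erase 2, (q ^ 2 - 1).factorization 2 +
      B * ∑ p ∈ s, (v p).factorization 2 + B * N.primeFactors.card + B)) :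
    2 ^ e ≤ 2 ^ (12 + B) * N ^ (2 + B) * (∏ p ∈ N.primeFactors, v p) ^ B := by
  have h1 := two_pow_sum_factorization_sq_sub_one_le hN
  have h2 := two_pow_card_primeFactors_le hN
  have h3 := two_pow_sum_factorization_le_prod v hs hv
  -- keep the big sums atomic
  generalize ∑ q ∈ N.primeFactors.erase 2, (q ^ 2 - 1).factorization 2 = Sq at h1 he
  generalize ∑ p ∈ s, (v p).factorization 2 = Sp at h3 he
  generalize N.primeFactors.card = ω at h2 he
  generalize ∏ p ∈ N.primeFactors, v p = P at h3
  have h2' : (2 ^ ω) ^ B ≤ N ^ B := Nat.pow_le_pow_left h2 B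
  have h3' : (2 ^ Sp) ^ B ≤ P ^ B := Nat.pow_le_pow_left h3 B
  have hexp : 2 ^ e ≤ 2 ^ (12 + (Sq + B * Sp + B * ω + B)) := Nat.pow_le_pow_right (by norm_num) he
  have hsplit : 2 ^ (12 + (Sq + B * Sp + B * ω + B)) =
      2 ^ 12 * 2 ^ Sq * (2 ^ Sp) ^ B * (2 ^ ω) ^ B * 2 ^ B := by
    rw [pow_add, pow_add, pow_add, pow_add, pow_mul', pow_mul']
    simp only [mul_assoc]
  have hprod : 2 ^ 12 * 2 ^ Sq * (2 ^ Sp) ^ B * (2 ^ ω) ^ B * 2 ^ B ≤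
      2 ^ 12 * N ^ 2 * P ^ B * N ^ B * 2 ^ B :=
    Nat.mul_le_mul_right _ (Nat.mul_le_mul (Nat.mul_le_mul (Nat.mul_le_mul_left _ h1) h3') h2')
  have hfinal : 2 ^ 12 * N ^ 2 * P ^ B * N ^ B * 2 ^ B = 2 ^ (12 + B) * N ^ (2 + B) * P ^ B := by
    rw [pow_add, pow_add]
    simp only [mul_assoc, mul_comm, mul_left_comm]
  calc 2 ^ e ≤ 2 ^ (12 + (Sq + B * Sp + B * ω + B)) := hexp
    _ = 2 ^ 12 * 2 ^ Sq * (2 ^ Sp) ^ B * (2 ^ ω) ^ B * 2 ^ B := hsplit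
    _ ≤ 2 ^ 12 * N ^ 2 * P ^ B * N ^ B * 2 ^ B := hprod
    _ = 2 ^ (12 + B) * N ^ (2 + B) * P ^ B := hfinal

/-- **Core of the reduction (explicit constants).**  With stub 1 (`h1`), stub 2 (`h2`), the 2-adic law
for a fixed `B` (`hB`, the body of stub 3) and the odd-part bound with constants `A₅, C₅` (`hC₅`), every
`ξ(E_(a,b); N/Nm, Nm)` on the crux's domain satisfies
`ξ ≤ 2^{12+B} · N^{2+B} · P^B · (max C₅ 0 · N^{A₅})`, `P = ∏_{p ∣ N} ord_p Δ_min` (no bound on `P` used yet). -/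
theorem xi_le_core
    (h1 : ∀ a b : ℤ, IsCoprime a b → a * b * (a + b) ≠ 0 → ∀ p : ℕ, p.Prime → p ≠ 2 →
      ¬ (p : ℤ) ∣ a * b * (a + b) → (4 : ℤ) ∣ (p : ℤ) + 1 - (freyCurve a b).LFunction p)
    (h2 : ∀ {Nplus Nminus : ℕ} (S : Brandt.XiSetup Nplus Nminus) (lam : ℕ → ℤ)
      [Fintype (Brandt.ClassSet S.O)],
      ∀ φ : Brandt.ClassSet S.O → ℤ, φ ≠ 0 →
        Brandt.eigenLattice (Nplus * Nminus) (Brandt.matrix S.O) lam = ℤ ∙ φ →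
        ∀ D : ℕ, (∀ c d : Brandt.ClassSet S.O,
            (S.xi lam : ℤ) ∣ (D : ℤ) * (Brandt.weight S.O d : ℤ) * φ d * φ c) →
          S.xi lam ∣ 12 * D)
    {B : ℕ}
    (hB : ∀ a b : ℤ, IsCoprime a b → a * b * (a + b) ≠ 0 →
      (∀ p : ℕ, p.Prime → p ≠ 2 → ¬ (p : ℤ) ∣ a * b * (a + b) →
        (4 : ℤ) ∣ (p : ℤ) + 1 - (freyCurve a b).LFunction p) →
      ∀ (N : ℕ) [NeZero N], (freyCurve a b).conductorNorm ℤ = N →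
      ∀ Nm : ℕ, Odd Nm → Squarefree Nm → Odd Nm.primeFactors.card → Nm ∣ N →
      ∀ (S : Brandt.XiSetup (N / Nm) Nm) [Fintype (Brandt.ClassSet S.O)],
        ∀ φ : Brandt.ClassSet S.O → ℤ, φ ≠ 0 →
          Brandt.eigenLattice (N / Nm * Nm) (Brandt.matrix S.O)
              (fun n => (freyCurve a b).LFunction n) = ℤ ∙ φ →
          ∃ D : ℕ, 0 < D ∧
            D.factorization 2 ≤
              ∑ q ∈ N.primeFactors.erase 2, (q ^ 2 - 1).factorization 2 +
                B * ∑ p ∈ (N / Nm).primeFactors,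
                  (((freyCurve a b).minimalDiscriminantNorm ℤ).factorization p).factorization 2 +
                B * N.primeFactors.card + B ∧
            ∃ M ∈ Algebra.adjoin ℤ (Set.range fun n : ℕ => Brandt.matrix S.O (n + 1)),
              ∀ c d : Brandt.ClassSet S.O,
                (S.xi (fun n => (freyCurve a b).LFunction n) : ℤ) * M c d =
                  (D : ℤ) * (Brandt.weight S.O d : ℤ) * φ d * φ c)
    {A₅ C₅ : ℝ}
    (hC₅ : ∀ a b : ℤ, IsCoprime a b → a * b * (a + b) ≠ 0 → ∀ (N : ℕ) [NeZero N],
      (freyCurve a b).conductorNorm ℤ = N → ∀ Nm : ℕ, Odd Nm → Squarefree Nm →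
      Odd Nm.primeFactors.card → Nm ∣ N →
      ((brandtXi (N / Nm) Nm (fun n => (freyCurve a b).LFunction n) /
          2 ^ (brandtXi (N / Nm) Nm (fun n => (freyCurve a b).LFunction n)).factorization 2 : ℕ) : ℝ)
        ≤ C₅ * (N : ℝ) ^ A₅)
    {a b : ℤ} (hab : IsCoprime a b) (h0 : a * b * (a + b) ≠ 0) (N : ℕ) [NeZero N]
    (hN : (freyCurve a b).conductorNorm ℤ = N) (Nm : ℕ) (hodd : Odd Nm) (hsq : Squarefree Nm)
    (hcard : Odd Nm.primeFactors.card) (hdvd : Nm ∣ N) :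
    (brandtXi (N / Nm) Nm (fun n => (freyCurve a b).LFunction n) : ℝ) ≤
      (2 : ℝ) ^ (12 + B) * (N : ℝ) ^ (2 + B) *
        ((∏ p ∈ N.primeFactors, ((freyCurve a b).minimalDiscriminantNorm ℤ).factorization p : ℕ)
          : ℝ) ^ B * (max C₅ 0 * (N : ℝ) ^ A₅) := by
  have hN0 : N ≠ 0 := NeZero.ne N
  have hNpos : (0 : ℝ) < N := by exact_mod_cast Nat.pos_of_ne_zero hN0
  haveI := isElliptic_freyCurve h0
  have hv_ne : ∀ p ∈ N.primeFactors,
      ((freyCurve a b).minimalDiscriminantNorm ℤ).factorization p ≠ 0 := by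
    intro p hp
    rw [← hN, primeFactors_conductorNorm_eq (freyCurve a b), ← Nat.support_factorization] at hp
    exact Finsupp.mem_support_iff.mp hp
  -- the odd part and its real bound (stub 5)
  have hm_le := (hC₅ a b hab h0 N hN Nm hodd hsq hcard hdvd).trans
      (mul_le_mul_of_nonneg_right (le_max_left C₅ 0) (Real.rpow_nonneg hNpos.le A₅))
  -- the 2-primary part (stubs 1, 2, 3)
  have h2pow : 2 ^ (brandtXi (N / Nm) Nm (fun n => (freyCurve a b).LFunction n)).factorization 2 ≤
      2 ^ (12 + B) * N ^ (2 + B) *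
        (∏ p ∈ N.primeFactors, ((freyCurve a b).minimalDiscriminantNorm ℤ).factorization p) ^ B := by
    by_cases hξ0 : brandtXi (N / Nm) Nm (fun n => (freyCurve a b).LFunction n) = 0
    · rw [hξ0, Nat.factorization_zero, Finsupp.zero_apply, pow_zero]
      have hPpos : 0 < ∏ p ∈ N.primeFactors,
          ((freyCurve a b).minimalDiscriminantNorm ℤ).factorization p :=
        Finset.prod_pos fun p hp => Nat.pos_of_ne_zero (hv_ne p hp)
      exact Nat.mul_pos (Nat.mul_pos (by positivity) (by positivity)) (pow_pos hPpos B)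
    · -- a Brandt setup of type `(N/Nm, Nm)` exists on the crux's domain (landed Negative lemma)
      have hne := nonempty_xiSetup_freyCurve hab h0 hodd hsq hcard (by rw [hN]; exact hdvd)
      rw [hN] at hne
      obtain ⟨S⟩ := hne
      letI : Fintype (Brandt.ClassSet S.O) := Fintype.ofFinite _
      have hξS : brandtXi (N / Nm) Nm (fun n => (freyCurve a b).LFunction n) =
          S.xi (fun n => (freyCurve a b).LFunction n) := S.brandtXi_eq_xi _
      by_cases hline : ∃ φ : Brandt.ClassSet S.O → ℤ, φ ≠ 0 ∧
          Brandt.eigenLattice (N / Nm * Nm) (Brandt.matrix S.O)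
            (fun n => (freyCurve a b).LFunction n) = ℤ ∙ φ
      · obtain ⟨φ, hφ, hL⟩ := hline
        obtain ⟨D, hDpos, hlaw, M, -, hM⟩ :=
          hB a b hab h0 (h1 a b hab h0) N hN Nm hodd hsq hcard hdvd S φ hφ hL
        have hdvd12 : S.xi (fun n => (freyCurve a b).LFunction n) ∣ 12 * D :=
          h2 S _ φ hφ hL D fun c d => ⟨M c d, (hM c d).symm⟩
        have hξne : S.xi (fun n => (freyCurve a b).LFunction n) ≠ 0 := hξS ▸ hξ0
        have h12D : 12 * D ≠ 0 := Nat.mul_ne_zero (by norm_num) hDpos.ne'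
        have hfac := (Nat.factorization_le_iff_dvd hξne h12D).mpr hdvd12 2
        rw [Nat.factorization_mul (by norm_num) hDpos.ne', Finsupp.add_apply] at hfac
        have h12 : (12 : ℕ).factorization 2 < 12 := Nat.factorization_lt 2 (by norm_num)
        refine two_pow_le_of_law hN0 (s := (N / Nm).primeFactors)
          (fun p => ((freyCurve a b).minimalDiscriminantNorm ℤ).factorization p)
          (Nat.primeFactors_mono (Nat.div_dvd_of_dvd hdvd) hN0) hv_ne ?_
        rw [hξS]
        omega
      · exact absurd (by rw [hξS, Brandt.XiSetup.xi, Brandt.xiOfOrder_eq,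
          Brandt.xi_of_not_isLine _ hline]) hξ0
  -- assemble: ξ = 2^{v₂ ξ} · odd part
  have hdecomp := (Nat.ordProj_mul_ordCompl_eq_self
    (brandtXi (N / Nm) Nm (fun n => (freyCurve a b).LFunction n)) 2).symm
  calc (brandtXi (N / Nm) Nm (fun n => (freyCurve a b).LFunction n) : ℝ)
      = ((2 ^ (brandtXi (N / Nm) Nm (fun n => (freyCurve a b).LFunction n)).factorization 2 : ℕ)
            : ℝ) *
          ((brandtXi (N / Nm) Nm (fun n => (freyCurve a b).LFunction n) /
            2 ^ (brandtXi (N / Nm) Nm (fun n => (freyCurve a b).LFunction n)).factorization 2 : ℕ)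
            : ℝ) := by
        exact_mod_cast hdecomp
    _ ≤ ((2 ^ (12 + B) * N ^ (2 + B) *
          (∏ p ∈ N.primeFactors, ((freyCurve a b).minimalDiscriminantNorm ℤ).factorization p) ^ B
            : ℕ) : ℝ) * (max C₅ 0 * (N : ℝ) ^ A₅) :=
        mul_le_mul (by exact_mod_cast h2pow) hm_le (Nat.cast_nonneg _) (Nat.cast_nonneg _)
    _ = (2 : ℝ) ^ (12 + B) * (N : ℝ) ^ (2 + B) *
          ((∏ p ∈ N.primeFactors, ((freyCurve a b).minimalDiscriminantNorm ℤ).factorization p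
            : ℕ) : ℝ) ^ B * (max C₅ 0 * (N : ℝ) ^ A₅) := by
        push_cast
        ring

/-- **The reduction, closed form (no sorry; planner rev 1, unchanged in substance):** the five stub
statements (stub 4 = a polynomial bound on the exponent product `∏_{p ∣ N} ord_p Δ_min`) imply the crux,
stated with the crux unfolded (only `XiBound_of` concludes the route decl by name). -/
theorem of_parts
    (h1 : ∀ a b : ℤ, IsCoprime a b → a * b * (a + b) ≠ 0 → ∀ p : ℕ, p.Prime → p ≠ 2 →
      ¬ (p : ℤ) ∣ a * b * (a + b) → (4 : ℤ) ∣ (p : ℤ) + 1 - (freyCurve a b).LFunction p)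
    (h2 : ∀ {Nplus Nminus : ℕ} (S : Brandt.XiSetup Nplus Nminus) (lam : ℕ → ℤ)
      [Fintype (Brandt.ClassSet S.O)],
      ∀ φ : Brandt.ClassSet S.O → ℤ, φ ≠ 0 →
        Brandt.eigenLattice (Nplus * Nminus) (Brandt.matrix S.O) lam = ℤ ∙ φ →
        ∀ D : ℕ, (∀ c d : Brandt.ClassSet S.O,
            (S.xi lam : ℤ) ∣ (D : ℤ) * (Brandt.weight S.O d : ℤ) * φ d * φ c) →
          S.xi lam ∣ 12 * D)
    (h3 : ∃ B : ℕ, ∀ a b : ℤ, IsCoprime a b → a * b * (a + b) ≠ 0 →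
      (∀ p : ℕ, p.Prime → p ≠ 2 → ¬ (p : ℤ) ∣ a * b * (a + b) →
        (4 : ℤ) ∣ (p : ℤ) + 1 - (freyCurve a b).LFunction p) →
      ∀ (N : ℕ) [NeZero N], (freyCurve a b).conductorNorm ℤ = N →
      ∀ Nm : ℕ, Odd Nm → Squarefree Nm → Odd Nm.primeFactors.card → Nm ∣ N →
      ∀ (S : Brandt.XiSetup (N / Nm) Nm) [Fintype (Brandt.ClassSet S.O)],
        ∀ φ : Brandt.ClassSet S.O → ℤ, φ ≠ 0 →
          Brandt.eigenLattice (N / Nm * Nm) (Brandt.matrix S.O)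
              (fun n => (freyCurve a b).LFunction n) = ℤ ∙ φ →
          ∃ D : ℕ, 0 < D ∧
            D.factorization 2 ≤
              ∑ q ∈ N.primeFactors.erase 2, (q ^ 2 - 1).factorization 2 +
                B * ∑ p ∈ (N / Nm).primeFactors,
                  (((freyCurve a b).minimalDiscriminantNorm ℤ).factorization p).factorization 2 +
                B * N.primeFactors.card + B ∧
            ∃ M ∈ Algebra.adjoin ℤ (Set.range fun n : ℕ => Brandt.matrix S.O (n + 1)),
              ∀ c d : Brandt.ClassSet S.O,
                (S.xi (fun n => (freyCurve a b).LFunction n) : ℤ) * M c d =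
                  (D : ℤ) * (Brandt.weight S.O d : ℤ) * φ d * φ c)
    (h4 : ∃ A C : ℝ, ∀ a b : ℤ, IsCoprime a b → a * b * (a + b) ≠ 0 → ∀ (N : ℕ) [NeZero N],
      (freyCurve a b).conductorNorm ℤ = N →
      ((∏ p ∈ N.primeFactors, ((freyCurve a b).minimalDiscriminantNorm ℤ).factorization p : ℕ) : ℝ)
        ≤ C * (N : ℝ) ^ A)
    (h5 : ∃ A C : ℝ, ∀ a b : ℤ, IsCoprime a b → a * b * (a + b) ≠ 0 → ∀ (N : ℕ) [NeZero N],
      (freyCurve a b).conductorNorm ℤ = N → ∀ Nm : ℕ, Odd Nm → Squarefree Nm →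
      Odd Nm.primeFactors.card → Nm ∣ N →
      ((brandtXi (N / Nm) Nm (fun n => (freyCurve a b).LFunction n) /
          2 ^ (brandtXi (N / Nm) Nm (fun n => (freyCurve a b).LFunction n)).factorization 2 : ℕ) : ℝ)
        ≤ C * (N : ℝ) ^ A) :
    ∃ A C : ℝ, ∀ a b : ℤ, IsCoprime a b → a * b * (a + b) ≠ 0 → ∀ (N : ℕ) [NeZero N],
      (freyCurve a b).conductorNorm ℤ = N → ∀ Nm : ℕ, Odd Nm → Squarefree Nm →
      Odd Nm.primeFactors.card → Nm ∣ N →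
      (brandtXi (N / Nm) Nm (fun n => (freyCurve a b).LFunction n) : ℝ) ≤ C * (N : ℝ) ^ A := by
  obtain ⟨B, hB⟩ := h3
  obtain ⟨A₄, C₄, hC₄⟩ := h4
  obtain ⟨A₅, C₅, hC₅⟩ := h5
  refine ⟨((2 + B : ℕ) : ℝ) + A₄ * B + A₅, (2 : ℝ) ^ (12 + B) * (max C₄ 0) ^ B * max C₅ 0, ?_⟩
  intro a b hab h0 N _ hN Nm hodd hsq hcard hdvd
  have hN0 : N ≠ 0 := NeZero.ne N
  have hNpos : (0 : ℝ) < N := by exact_mod_cast Nat.pos_of_ne_zero hN0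
  -- the exponent product and its real bound (stub 4)
  have hP_le : ((∏ p ∈ N.primeFactors, ((freyCurve a b).minimalDiscriminantNorm ℤ).factorization p
      : ℕ) : ℝ) ≤ max C₄ 0 * (N : ℝ) ^ A₄ :=
    (hC₄ a b hab h0 N hN).trans
      (mul_le_mul_of_nonneg_right (le_max_left _ _) (Real.rpow_nonneg hNpos.le _))
  calc (brandtXi (N / Nm) Nm (fun n => (freyCurve a b).LFunction n) : ℝ)
      ≤ (2 : ℝ) ^ (12 + B) * (N : ℝ) ^ (2 + B) *
          ((∏ p ∈ N.primeFactors, ((freyCurve a b).minimalDiscriminantNorm ℤ).factorization p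
            : ℕ) : ℝ) ^ B * (max C₅ 0 * (N : ℝ) ^ A₅) :=
        xi_le_core h1 h2 hB hC₅ hab h0 N hN Nm hodd hsq hcard hdvd
    _ ≤ (2 : ℝ) ^ (12 + B) * (N : ℝ) ^ (2 + B) * (max C₄ 0 * (N : ℝ) ^ A₄) ^ B *
          (max C₅ 0 * (N : ℝ) ^ A₅) := by
        gcongr
    _ = (2 : ℝ) ^ (12 + B) * (max C₄ 0) ^ B * max C₅ 0 *
          ((N : ℝ) ^ (((2 + B : ℕ)) : ℝ) * (N : ℝ) ^ (A₄ * B) * (N : ℝ) ^ A₅) := by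
        rw [mul_pow, ← Real.rpow_natCast (N : ℝ) (2 + B), ← Real.rpow_mul_natCast hNpos.le A₄ B]
        ring
    _ = (2 : ℝ) ^ (12 + B) * (max C₄ 0) ^ B * max C₅ 0 *
          (N : ℝ) ^ (((2 + B : ℕ) : ℝ) + A₄ * B + A₅) := by
        rw [Real.rpow_add hNpos, Real.rpow_add hNpos]

/-- **The `δ`-weak bound (rev 5; the third antecedent of `stub_szpiroBootstrap`):** stubs 1, 2, 3, 5 alone
give `ξ ≤ C_δ · N^A · |Δ_min|^δ` for every `δ > 0` with ONE absolute `A = 2 + B + A₅`, because the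
exponent product is sub-polynomial in `|Δ_min|` (`∏_{p∣N} ord_p Δ_min ≤ A_η |Δ_min|^η`,
`Summit.ABC.ABC.Theorems.ManyPrimeValuationProduct.prod_factorization_le_rpow`, the divisor-bound argument). -/
theorem of_parts_delta
    (h1 : ∀ a b : ℤ, IsCoprime a b → a * b * (a + b) ≠ 0 → ∀ p : ℕ, p.Prime → p ≠ 2 →
      ¬ (p : ℤ) ∣ a * b * (a + b) → (4 : ℤ) ∣ (p : ℤ) + 1 - (freyCurve a b).LFunction p)
    (h2 : ∀ {Nplus Nminus : ℕ} (S : Brandt.XiSetup Nplus Nminus) (lam : ℕ → ℤ)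
      [Fintype (Brandt.ClassSet S.O)],
      ∀ φ : Brandt.ClassSet S.O → ℤ, φ ≠ 0 →
        Brandt.eigenLattice (Nplus * Nminus) (Brandt.matrix S.O) lam = ℤ ∙ φ →
        ∀ D : ℕ, (∀ c d : Brandt.ClassSet S.O,
            (S.xi lam : ℤ) ∣ (D : ℤ) * (Brandt.weight S.O d : ℤ) * φ d * φ c) →
          S.xi lam ∣ 12 * D)
    (h3 : ∃ B : ℕ, ∀ a b : ℤ, IsCoprime a b → a * b * (a + b) ≠ 0 →
      (∀ p : ℕ, p.Prime → p ≠ 2 → ¬ (p : ℤ) ∣ a * b * (a + b) →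
        (4 : ℤ) ∣ (p : ℤ) + 1 - (freyCurve a b).LFunction p) →
      ∀ (N : ℕ) [NeZero N], (freyCurve a b).conductorNorm ℤ = N →
      ∀ Nm : ℕ, Odd Nm → Squarefree Nm → Odd Nm.primeFactors.card → Nm ∣ N →
      ∀ (S : Brandt.XiSetup (N / Nm) Nm) [Fintype (Brandt.ClassSet S.O)],
        ∀ φ : Brandt.ClassSet S.O → ℤ, φ ≠ 0 →
          Brandt.eigenLattice (N / Nm * Nm) (Brandt.matrix S.O)
              (fun n => (freyCurve a b).LFunction n) = ℤ ∙ φ →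
          ∃ D : ℕ, 0 < D ∧
            D.factorization 2 ≤
              ∑ q ∈ N.primeFactors.erase 2, (q ^ 2 - 1).factorization 2 +
                B * ∑ p ∈ (N / Nm).primeFactors,
                  (((freyCurve a b).minimalDiscriminantNorm ℤ).factorization p).factorization 2 +
                B * N.primeFactors.card + B ∧
            ∃ M ∈ Algebra.adjoin ℤ (Set.range fun n : ℕ => Brandt.matrix S.O (n + 1)),
              ∀ c d : Brandt.ClassSet S.O,
                (S.xi (fun n => (freyCurve a b).LFunction n) : ℤ) * M c d =
                  (D : ℤ) * (Brandt.weight S.O d : ℤ) * φ d * φ c)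
    (h5 : ∃ A C : ℝ, ∀ a b : ℤ, IsCoprime a b → a * b * (a + b) ≠ 0 → ∀ (N : ℕ) [NeZero N],
      (freyCurve a b).conductorNorm ℤ = N → ∀ Nm : ℕ, Odd Nm → Squarefree Nm →
      Odd Nm.primeFactors.card → Nm ∣ N →
      ((brandtXi (N / Nm) Nm (fun n => (freyCurve a b).LFunction n) /
          2 ^ (brandtXi (N / Nm) Nm (fun n => (freyCurve a b).LFunction n)).factorization 2 : ℕ) : ℝ)
        ≤ C * (N : ℝ) ^ A) :
    ∃ A : ℝ, ∀ δ : ℝ, 0 < δ → ∃ C : ℝ, ∀ a b : ℤ, IsCoprime a b → a * b * (a + b) ≠ 0 →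
      ∀ (N : ℕ) [NeZero N], (freyCurve a b).conductorNorm ℤ = N →
      ∀ Nm : ℕ, Odd Nm → Squarefree Nm → Odd Nm.primeFactors.card → Nm ∣ N →
      (brandtXi (N / Nm) Nm (fun n => (freyCurve a b).LFunction n) : ℝ) ≤
        C * (N : ℝ) ^ A * (((freyCurve a b).minimalDiscriminantNorm ℤ : ℕ) : ℝ) ^ δ := by
  obtain ⟨B, hB⟩ := h3
  obtain ⟨A₅, C₅, hC₅⟩ := h5
  refine ⟨((2 + B : ℕ) : ℝ) + A₅, fun δ hδ => ?_⟩
  -- the exponent product is sub-polynomial in `|Δ_min|`: exponent `η = δ / (B + 1)` per factor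
  have hη : 0 < δ / (B + 1) := div_pos hδ (by positivity)
  obtain ⟨Aη, hAη, hA⟩ := Summit.ABC.ABC.Theorems.ManyPrimeValuationProduct.prod_factorization_le_rpow hη
  refine ⟨(2 : ℝ) ^ (12 + B) * Aη ^ B * max C₅ 0, ?_⟩
  intro a b hab h0 N _ hN Nm hodd hsq hcard hdvd
  have hN0 : N ≠ 0 := NeZero.ne N
  have hNpos : (0 : ℝ) < N := by exact_mod_cast Nat.pos_of_ne_zero hN0
  haveI := isElliptic_freyCurve h0
  have hΔpos : 0 < (freyCurve a b).minimalDiscriminantNorm ℤ :=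
    (freyCurve a b).minimalDiscriminantNorm_pos_holds
  set Δ : ℕ := (freyCurve a b).minimalDiscriminantNorm ℤ with hΔdef
  have hΔ0 : Δ ≠ 0 := hΔpos.ne'
  have hΔ1 : (1 : ℝ) ≤ Δ := by exact_mod_cast Nat.one_le_iff_ne_zero.mpr hΔ0
  have hsub : N.primeFactors ⊆ Δ.primeFactors := by
    rw [← hN, primeFactors_conductorNorm_eq (freyCurve a b)]
  -- `P ≤ A_η |Δ|^η`, hence `P^B ≤ A_η^B |Δ|^{η B} ≤ A_η^B |Δ|^δ`
  have hP : ((∏ p ∈ N.primeFactors, Δ.factorization p : ℕ) : ℝ) ≤ Aη * (Δ : ℝ) ^ (δ / (B + 1)) :=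
    hA Δ hΔ0 _ hsub
  have hPB : ((∏ p ∈ N.primeFactors, Δ.factorization p : ℕ) : ℝ) ^ B ≤ Aη ^ B * (Δ : ℝ) ^ δ := by
    calc ((∏ p ∈ N.primeFactors, Δ.factorization p : ℕ) : ℝ) ^ B
        ≤ (Aη * (Δ : ℝ) ^ (δ / (B + 1))) ^ B := by gcongr
      _ = Aη ^ B * (Δ : ℝ) ^ (δ / (B + 1) * B) := by
          rw [mul_pow, Real.rpow_mul_natCast (by positivity)]
      _ ≤ Aη ^ B * (Δ : ℝ) ^ δ := by
          gcongr
          rw [div_mul_eq_mul_div, div_le_iff₀ (by positivity)]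
          nlinarith
  calc (brandtXi (N / Nm) Nm (fun n => (freyCurve a b).LFunction n) : ℝ)
      ≤ (2 : ℝ) ^ (12 + B) * (N : ℝ) ^ (2 + B) *
          ((∏ p ∈ N.primeFactors, Δ.factorization p : ℕ) : ℝ) ^ B * (max C₅ 0 * (N : ℝ) ^ A₅) :=
        xi_le_core h1 h2 hB hC₅ hab h0 N hN Nm hodd hsq hcard hdvd
    _ ≤ (2 : ℝ) ^ (12 + B) * (N : ℝ) ^ (2 + B) * (Aη ^ B * (Δ : ℝ) ^ δ) *
          (max C₅ 0 * (N : ℝ) ^ A₅) := by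
        gcongr
    _ = (2 : ℝ) ^ (12 + B) * Aη ^ B * max C₅ 0 *
          ((N : ℝ) ^ (((2 + B : ℕ)) : ℝ) * (N : ℝ) ^ A₅) * (Δ : ℝ) ^ δ := by
        rw [← Real.rpow_natCast (N : ℝ) (2 + B)]
        ring
    _ = (2 : ℝ) ^ (12 + B) * Aη ^ B * max C₅ 0 * (N : ℝ) ^ (((2 + B : ℕ) : ℝ) + A₅) *
          (Δ : ℝ) ^ δ := by
        rw [Real.rpow_add hNpos]

/-- **Polynomial Szpiro pays the allowance (rev 4/5):** a polynomial bound `|Δ_min(E_(a,b))| ≤ C N^κ`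
gives the polynomial exponent-product bound consumed by `of_parts` (stub 4 of rev 1), via
`∏_{p ∣ N} ord_p Δ_min ≤ A₁ |Δ_min|` (`prod_factorization_le_rpow` with exponent `1`). -/
theorem exponentProductFrey_of_polySzpiro
    (h : ∃ κ C : ℝ, ∀ a b : ℤ, IsCoprime a b → a * b * (a + b) ≠ 0 →
      ∀ (N : ℕ) [NeZero N], (freyCurve a b).conductorNorm ℤ = N →
      (((freyCurve a b).minimalDiscriminantNorm ℤ : ℕ) : ℝ) ≤ C * (N : ℝ) ^ κ) :
    ∃ A C : ℝ, ∀ a b : ℤ, IsCoprime a b → a * b * (a + b) ≠ 0 → ∀ (N : ℕ) [NeZero N],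
      (freyCurve a b).conductorNorm ℤ = N →
      ((∏ p ∈ N.primeFactors, ((freyCurve a b).minimalDiscriminantNorm ℤ).factorization p : ℕ) : ℝ)
        ≤ C * (N : ℝ) ^ A := by
  obtain ⟨κ, C, hC⟩ := h
  obtain ⟨A₁, hA₁, hA⟩ := Summit.ABC.ABC.Theorems.ManyPrimeValuationProduct.prod_factorization_le_rpow one_pos
  refine ⟨κ, A₁ * C, fun a b hab h0 N _ hN => ?_⟩
  haveI := isElliptic_freyCurve h0
  have hΔpos : 0 < (freyCurve a b).minimalDiscriminantNorm ℤ :=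
    (freyCurve a b).minimalDiscriminantNorm_pos_holds
  have hΔ0 : (freyCurve a b).minimalDiscriminantNorm ℤ ≠ 0 := hΔpos.ne'
  have hsub : N.primeFactors ⊆ ((freyCurve a b).minimalDiscriminantNorm ℤ).primeFactors := by
    rw [← hN, primeFactors_conductorNorm_eq (freyCurve a b)]
  calc ((∏ p ∈ N.primeFactors, ((freyCurve a b).minimalDiscriminantNorm ℤ).factorization p : ℕ) : ℝ)
      ≤ A₁ * (((freyCurve a b).minimalDiscriminantNorm ℤ : ℕ) : ℝ) ^ (1 : ℝ) := hA _ hΔ0 _ hsub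
    _ = A₁ * (((freyCurve a b).minimalDiscriminantNorm ℤ : ℕ) : ℝ) := by rw [Real.rpow_one]
    _ ≤ A₁ * (C * (N : ℝ) ^ κ) := by gcongr; exact hC a b hab h0 N hN
    _ = A₁ * C * (N : ℝ) ^ κ := by ring

/-- **Skeleton theorem (rev 5)**: the crux BY NAME from the registered stubs — 3a ∧ 3b give the
planners' stub 3; stubs 1, 2 are the landed theorems; the allowance is paid by the Szpiro bootstrap
(4a, 4b, 4c applied to the `δ`-weak bound `of_parts_delta`) through `exponentProductFrey_of_polySzpiro`;
stub 5 is the odd part. -/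
theorem XiBound_of : Summit.ABC.ABC.Theses.DefiniteXi.XiBound :=
  have h3 := twoAdicCongruenceExponent_of_stubs Summit.ABC.ABC.Theorems.stub_heckeProjectorExists
    stub_twoAdicLawMinimalExponent
  of_parts Summit.ABC.ABC.Theorems.stub_freyEisensteinModFour
    Summit.ABC.ABC.Theorems.stub_xiDvdTwelveCongruenceExponent h3
    (exponentProductFrey_of_polySzpiro
      (Summit.ABC.ABC.Theorems.stub_szpiroBootstrap stub_definiteRTControlPrime stub_freyModularity
        (of_parts_delta Summit.ABC.ABC.Theorems.stub_freyEisensteinModFour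
          Summit.ABC.ABC.Theorems.stub_xiDvdTwelveCongruenceExponent h3 stub_oddPartXiBound)))
    stub_oddPartXiBound

end Summit.ABC.ABC.Cruxes.XiBound.TwoAdicRedeiDepth
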